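import Literature.NumberTheory.Automorphic.ClozelAlgebraicityConjugatesProofs
import Literature.NumberTheory.NumberFields.TotallyRealOrCM
import HarnessLib

/-!
# Clozel's algebraicity fact: clause (iv) ("`ℚ(π_f)` is totally real or CM") reduced to the
# commutation of complex conjugation with `Aut(ℂ)`-conjugation (proofs)

Proofs-only companion (theorems, no definitions, no named facts) of `ClozelAlgebraicity.lean`.
Clause (iv) of `Clozel1990_regularAlgebraic` — the rationality field `ratField π` (the fixed
field of the Hecke stabiliser `heckeStabilizer π ≤ Aut(ℂ)`) is totally real or CM — is, in print,
Patrikis 2019, Cor. 3.2.3: "we may assume `π` is unitary. The `L²` inner product then implies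
that `π^∨ ≅ ^cπ`, which in turn implies that for all `σ ∈ Aut(ℂ)`, `^{cσ}π ≅ ^{σc}π`, and
therefore that the fixed field `ℚ(π_f)` of `{σ ∈ Aut(ℂ) : ^σπ ≅ π}` is CM" (CM in his broad
sense, §2: CM or totally real). This file proves the "therefore": with `c ∈ Aut(ℂ)` complex
conjugation (`Complex.conjAe`, viewed in `ℂ ≃ₐ[ℚ] ℂ`),

* `isTotallyReal_or_isCMField_ratField_of_commutator_mem` — if `ratField π` is finite over `ℚ`
  (clause (i)) and every commutator `σ⁻¹ c⁻¹ σ c`, `σ ∈ Aut(ℂ)`, lies in `heckeStabilizer π`,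
  then `ratField π` is totally real or CM: the commutators fix `ratField π`, i.e. `c` commutes
  with every automorphism of `ℂ` on `ratField π`, and a subfield of `ℂ` finite over `ℚ` with
  this property is totally real or CM (`Subfield.isTotallyReal_or_isCMField_of_conj_comm` of
  `NumberFields/TotallyRealOrCM`: extension of embeddings to `Aut(ℂ)` and the fixed field of the
  restricted conjugation);
* `isTotallyReal_or_isCMField_ratField_of_isAutConjugate_conj` — the same with the hypothesis
  in Patrikis's form "`^{cσ}π ~ ^{σc}π` for all `σ`" (some `π'` is both a `cσ`- and a
  `σc`-conjugate of `π` at almost all places), using the action laws of `IsAutConjugate` and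
  `heckeStabilizer π = {σ : ^σπ ~ π}` from `ClozelAlgebraicityConjugatesProofs`.

What remains of clause (iv) after this file is the analytic input `π^∨ ≅ ^cπ` for unitary
cuspidal `π`, in Hecke eigenvalues: for a cuspidal regular algebraic `π` of purity weight `w`
(clause (iii)), `\overline{t_{v,i}} = q_v^{iw} t_{v,n-i} / t_{v,n}` at almost all `v` (unitarity
of `π ⊗ |det|^{-w/2}` and the adjoint `[K t_{v,i} K]^* = [K t_{v,i}⁻¹ K] = t_{v,n}⁻¹ [K t_{v,n-i} K]`
for the Petersson pairing). Granted this identity for `π` and for its cuspidal conjugates `^σπ`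
(clause (ii); same `w`), a `cσ`-conjugate of `π` has eigenvalues
`\overline{σ(t_{v,i})} = σ(q_v^{iw} t_{v,n-i}/t_{v,n}) = σ(\overline{t_{v,i}})`, i.e. is also a
`σc`-conjugate — the hypothesis of `isTotallyReal_or_isCMField_ratField_of_isAutConjugate_conj`.
That identity is not in the tree.

## References

* S. Patrikis, *Variations on a theorem of Tate*, Mem. AMS 258 (2019) = arXiv:1207.6724, §2 and
  Cor. 3.2.3 [Patrikis2019].
* L. Clozel, *Motifs et formes automorphes: applications du principe de fonctorialité*, in
  Automorphic forms, Shimura varieties, and L-functions I (Ann Arbor 1988), Academic Press 1990,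
  Thm. 3.13 [Clozel1990].
-/

noncomputable section

open scoped Classical ComplexConjugate
open NumberField IsDedekindDomain

namespace Literature.NumberTheory.Automorphic

variable {n : ℕ} {K : Type} [Field K] [NumberField K] {hcpt : isCompact_glFiniteIntegralLevel n K}

/-- **Clause (iv) from clause (i) and the commutators `[σ, c] ∈ heckeStabilizer π`.** Let
`c = Complex.conjAe ∈ Aut(ℂ)` be complex conjugation. If `ratField π` is finite over `ℚ` and
`σ⁻¹ c⁻¹ σ c ∈ heckeStabilizer π` for every `σ ∈ Aut(ℂ)`, then `ratField π` is totally real or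
CM: every element `z` of the fixed field `ratField π` satisfies `σ (c z) = c (σ z)` for every
automorphism `σ` of `ℂ`, and a subfield of `ℂ` finite over `ℚ` on which `c` commutes with
`Aut(ℂ)` is totally real or CM (`Subfield.isTotallyReal_or_isCMField_of_conj_comm`).
(Patrikis 2019, proof of Cor. 3.2.3: "… `^{cσ}π ≅ ^{σc}π`, and therefore … `ℚ(π_f)` … is CM".)
[cite: Patrikis2019, Cor. 3.2.3 (arXiv:1207.6724)] -/
theorem isTotallyReal_or_isCMField_ratField_of_commutator_mem
    (π : AutomorphicRepData (AutomorphyDatum.gl n K hcpt)) [hfd : FiniteDimensional ℚ (ratField π)]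
    (h : ∀ σ : ℂ ≃ₐ[ℚ] ℂ, σ⁻¹ * (Complex.conjAe.restrictScalars ℚ)⁻¹ * σ *
      Complex.conjAe.restrictScalars ℚ ∈ heckeStabilizer π) :
    IsTotallyReal (ratField π) ∨ IsCMField (ratField π) := by
  haveI : FiniteDimensional ℚ (ratField π).toSubfield := hfd
  refine Literature.NumberTheory.NumberFields.Subfield.isTotallyReal_or_isCMField_of_conj_comm
    (ratField π).toSubfield fun σ z hz ↦ ?_
  -- `σ` as a `ℚ`-algebra automorphism, and the commutator fixing `z ∈ ratField π`
  let σ' : ℂ ≃ₐ[ℚ] ℂ := AlgEquiv.ofRingEquiv (f := σ) fun q ↦ by simp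
  have hz' : z ∈ ratField π := hz
  have e := (mem_ratField_iff π z).mp hz' _ (h σ')
  rw [AlgEquiv.mul_apply, AlgEquiv.mul_apply, AlgEquiv.mul_apply, AlgEquiv.aut_inv,
    AlgEquiv.aut_inv] at e
  -- `e : σ'⁻¹ (c⁻¹ (σ' (c z))) = z`; apply `c ∘ σ'`
  have e2 := congrArg (fun w ↦ Complex.conjAe.restrictScalars ℚ (σ' w)) e
  simp only [AlgEquiv.apply_symm_apply] at e2
  exact e2

/-- **Clause (iv) from clause (i) and `^{cσ}π ~ ^{σc}π` (Patrikis 2019, Cor. 3.2.3).** If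
`ratField π` is finite over `ℚ` and, for every `σ ∈ Aut(ℂ)`, some `π'` is at almost all places
both a `cσ`-conjugate and a `σc`-conjugate of `π` (`c` = complex conjugation), then `ratField π`
is totally real or CM: by the action laws (`IsAutConjugate.trans`, `.symm`) `π` is its own
`(σc)⁻¹(cσ)`-conjugate, so this commutator lies in `heckeStabilizer π`
(`mem_heckeStabilizer_iff_isAutConjugate`), hence so does its inverse `σ⁻¹ c⁻¹ σ c`, and
`isTotallyReal_or_isCMField_ratField_of_commutator_mem` applies. The hypothesis is what
unitarity gives in print (`π^∨ ≅ ^cπ` for unitary cuspidal `π` and its conjugates), the input not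
formalised here. [cite: Patrikis2019, Cor. 3.2.3 (arXiv:1207.6724)] -/
theorem isTotallyReal_or_isCMField_ratField_of_isAutConjugate_conj
    (π : AutomorphicRepData (AutomorphyDatum.gl n K hcpt)) [FiniteDimensional ℚ (ratField π)]
    (h : ∀ σ : ℂ ≃ₐ[ℚ] ℂ, ∃ π' : AutomorphicRepData (AutomorphyDatum.gl n K hcpt),
      IsAutConjugate (Complex.conjAe.restrictScalars ℚ * σ) π π' ∧
        IsAutConjugate (σ * Complex.conjAe.restrictScalars ℚ) π π') :
    IsTotallyReal (ratField π) ∨ IsCMField (ratField π) := by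
  refine isTotallyReal_or_isCMField_ratField_of_commutator_mem π fun σ ↦ ?_
  obtain ⟨π', h₁, h₂⟩ := h σ
  have h₃ : IsAutConjugate ((σ * Complex.conjAe.restrictScalars ℚ)⁻¹ *
      (Complex.conjAe.restrictScalars ℚ * σ)) π π := h₁.trans h₂.symm
  have hmem := (mem_heckeStabilizer_iff_isAutConjugate π _).mpr h₃
  have key : ((σ * Complex.conjAe.restrictScalars ℚ)⁻¹ * (Complex.conjAe.restrictScalars ℚ * σ))⁻¹
      = σ⁻¹ * (Complex.conjAe.restrictScalars ℚ)⁻¹ * σ * Complex.conjAe.restrictScalars ℚ := by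
    group
  rw [← key]
  exact (heckeStabilizer π).inv_mem hmem

end Literature.NumberTheory.Automorphic
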